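import Mathlib
import Summits.ValiantsHypothesis.ValiantsHypothesis.Theorems.KPlusLogSqLawStepFourLook

/-!
# The FOUR-STEP LAW — the squeeze case `(R, R, L, L)` at window level (static path model behind `KPlusLogSqLaw.TropicalB`)

Cell pub-symmetroid, seat conjb-2 (g23). A helper toward the crux `TropicalB`
(`Summit.ValiantsHypothesis.ValiantsHypothesis.Theses.KPlusLogSqLaw.TropicalB`, item
`stmt-ValiantsHypothesis-19771`); it earns no crux credit and is not evidence for `MatrixDescartes` or for
Valiant's hypothesis.

SETTING as in `KPlusLogSqLawStepFourLook` (abstract upper class `up`; window `[u, v]` separated at `θ` iff every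
`up` line of `[u, v]` is strictly above every non-`up` line there; `T[u, v]` its separation set; rows step / move
right / move left).

CONTENT.
* INFIMUM STRUCTURES by transport of `KPlusLogSqLawStepTriple.step_inf_structure` (which describes `inf T[j, j+d]`
  facing `T[j+1, j+d+1]` on its left, tight pair through the outer upper line `j`):
  `inf_new_partner` — `inf T[i+1, i+d+1]` facing the PREVIOUS window `T[i, i+d]` on its left (row `i` moves right):
  the tight pair passes through the NEW line `i+d+1` (transport along the index reversal `t ↦ i+d+1-t`, lemmas
  `reidx_to` / `reidx_of` / `reidxle_of`); `inf_low_outer` — `inf T[i+3, i+d+3]` facing `T[i+4, i+d+4]` on its left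
  when the outer line `i+3` is a LOWER line (transport along the negation `up ↦ ¬ up`, `S ↦ -S`, lemmas `neg_to` /
  `neg_of` / `negle_of`).
* `sep_convex` — separation sets are intervals.
* `four_rrll` — FOUR-STEP LAW, pattern `(R, R, L, L)` on rows `i, …, i+3` (class pattern `up i`, `¬ up (i+1)`,
  `up (i+2)`, `¬ up (i+3)`, `up (i+d+1)`, `¬ up (i+d+2)`, `up (i+d+3)`, `¬ up (i+d+4)`, `d ≥ 3`) is impossible:
  `KPlusLogSqLawStepFour.four_rrll_core` fed with `ι₁ = inf T[i+1, i+d+1]` (`c(ι₁) ≤ 0` from the tight pair through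
  `i+d+1`, `c'(ι₁) ≤ 0` by closure of `KPlusLogSqLawStepFourOrder.gap_right_low`), `ι₃ = inf T[i+3, i+d+3]`
  (`c'(ι₃) ≥ 0` from the tight pair through `i+3`, `c(ι₃) ≥ 0` by closure of `gap_left_up`), the monotonicities of
  `c = S_{i+d+1} - S_{i+2}` / `c' = S_{i+3} - S_{i+d+2}` (triple laws), row-`(i+1)` exactness on
  `T[i+1, i+d+1] ∩ T[i+3, i+d+3]` witnessed by the pair `(i+2, i+d+2)` (`new_low_le`: the other upper lines beat
  `i+d+2` inside the window `i+3`), and the sign of `S_{i+2} - S_{i+3}` on `T[i, i+d]` and `T[i+2, i+d+2]`.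
With `KPlusLogSqLawStepFourLook.four_lrl` / `four_rlr` this exhausts the middle pattern `(R, L)`; the dispatch, the
reflected middle pattern `(L, R)` and the even/odd bridge are the sequel.
-/

set_option linter.dupNamespace false

namespace Summit.ValiantsHypothesis.ValiantsHypothesis.Theorems.KPlusLogSqLawStepFourInf

open Summit.ValiantsHypothesis.ValiantsHypothesis.Theorems.KPlusLogSqLawStepTriple (step_inf_structure)
open Summit.ValiantsHypothesis.ValiantsHypothesis.Theorems.KPlusLogSqLawStepFour (affine_le_at_inf four_rrll_core)
open Summit.ValiantsHypothesis.ValiantsHypothesis.Theorems.KPlusLogSqLawStepFourOrder (gap_left_up gap_right_low)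
open Summit.ValiantsHypothesis.ValiantsHypothesis.Theorems.KPlusLogSqLawStepTripleDual (triple_mid_right)
open Summit.ValiantsHypothesis.ValiantsHypothesis.Theorems.KPlusLogSqLawStepFourLook
  (sep_cast mono_low affine_pos_between not_sep_right new_low_le)

/-- Index reversal `t ↦ M - t`, forward: a window `[lo', hi'] = [M - hi, M - lo]` of the original lines separated at
`θ` is the window `[lo, hi]` of the reversed configuration separated at `θ`. -/
theorem reidx_to (up : ℕ → Prop) (s b : ℕ → ℝ) (M lo hi lo' hi' : ℕ) (h1 : lo' + hi = M) (h2 : hi' + lo = M)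
    (θ : ℝ) (h : (∀ e o : ℕ, lo' ≤ e → e ≤ hi' → lo' ≤ o → o ≤ hi' → up e → ¬ up o → b o + s o * θ < b e + s e * θ)) :
    (∀ e o : ℕ, lo ≤ e → e ≤ hi → lo ≤ o → o ≤ hi → up (M - e) → ¬ up (M - o) → b (M - o) + s (M - o) * θ < b (M - e) + s (M - e) * θ) := by
  intro e o g1 g2 g3 g4 he ho
  exact h (M - e) (M - o) (by omega) (by omega) (by omega) (by omega) he ho

/-- Index reversal `t ↦ M - t`, backward (strict comparisons). -/
theorem reidx_of (up : ℕ → Prop) (s b : ℕ → ℝ) (M lo hi lo' hi' : ℕ) (h1 : lo' + hi = M) (h2 : hi' + lo = M)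
    (θ : ℝ) (h : (∀ e o : ℕ, lo ≤ e → e ≤ hi → lo ≤ o → o ≤ hi → up (M - e) → ¬ up (M - o) → b (M - o) + s (M - o) * θ < b (M - e) + s (M - e) * θ)) :
    (∀ e o : ℕ, lo' ≤ e → e ≤ hi' → lo' ≤ o → o ≤ hi' → up e → ¬ up o → b o + s o * θ < b e + s e * θ) := by
  intro e o g1 g2 g3 g4 he ho
  have key := h (M - e) (M - o) (by omega) (by omega) (by omega) (by omega)
  rw [(by omega : M - (M - e) = e), (by omega : M - (M - o) = o)] at key
  exact key he ho

/-- Index reversal `t ↦ M - t`, backward (weak comparisons). -/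
theorem reidxle_of (up : ℕ → Prop) (s b : ℕ → ℝ) (M lo hi lo' hi' : ℕ) (h1 : lo' + hi = M) (h2 : hi' + lo = M)
    (θ : ℝ) (h : (∀ e o : ℕ, lo ≤ e → e ≤ hi → lo ≤ o → o ≤ hi → up (M - e) → ¬ up (M - o) → b (M - o) + s (M - o) * θ ≤ b (M - e) + s (M - e) * θ)) :
    (∀ e o : ℕ, lo' ≤ e → e ≤ hi' → lo' ≤ o → o ≤ hi' → up e → ¬ up o → b o + s o * θ ≤ b e + s e * θ) := by
  intro e o g1 g2 g3 g4 he ho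
  have key := h (M - e) (M - o) (by omega) (by omega) (by omega) (by omega)
  rw [(by omega : M - (M - e) = e), (by omega : M - (M - o) = o)] at key
  exact key he ho

/-- Negation `up ↦ ¬ up`, `S ↦ -S`, forward (with re-bracketing of the bounds): separation is preserved pointwise. -/
theorem neg_to (up : ℕ → Prop) (s b : ℕ → ℝ) (lo hi lo' hi' : ℕ) (h1 : lo = lo') (h2 : hi = hi') (θ : ℝ)
    (h : (∀ e o : ℕ, lo ≤ e → e ≤ hi → lo ≤ o → o ≤ hi → up e → ¬ up o → b o + s o * θ < b e + s e * θ)) :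
    (∀ e o : ℕ, lo' ≤ e → e ≤ hi' → lo' ≤ o → o ≤ hi' → ¬ up e → ¬ ¬ up o → -b o + -s o * θ < -b e + -s e * θ) := by
  intro e o g1 g2 g3 g4 he ho
  have := h o e (by omega) (by omega) (by omega) (by omega) (Classical.not_not.mp ho) he
  linarith

/-- Negation `up ↦ ¬ up`, `S ↦ -S`, backward (strict comparisons). -/
theorem neg_of (up : ℕ → Prop) (s b : ℕ → ℝ) (lo hi lo' hi' : ℕ) (h1 : lo = lo') (h2 : hi = hi') (θ : ℝ)
    (h : (∀ e o : ℕ, lo ≤ e → e ≤ hi → lo ≤ o → o ≤ hi → ¬ up e → ¬ ¬ up o → -b o + -s o * θ < -b e + -s e * θ)) :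
    (∀ e o : ℕ, lo' ≤ e → e ≤ hi' → lo' ≤ o → o ≤ hi' → up e → ¬ up o → b o + s o * θ < b e + s e * θ) := by
  intro e o g1 g2 g3 g4 he ho
  have := h o e (by omega) (by omega) (by omega) (by omega) ho (not_not_intro he)
  linarith

/-- Negation `up ↦ ¬ up`, `S ↦ -S`, backward (weak comparisons). -/
theorem negle_of (up : ℕ → Prop) (s b : ℕ → ℝ) (lo hi lo' hi' : ℕ) (h1 : lo = lo') (h2 : hi = hi') (θ : ℝ)
    (h : (∀ e o : ℕ, lo ≤ e → e ≤ hi → lo ≤ o → o ≤ hi → ¬ up e → ¬ ¬ up o → -b o + -s o * θ ≤ -b e + -s e * θ)) :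
    (∀ e o : ℕ, lo' ≤ e → e ≤ hi' → lo' ≤ o → o ≤ hi' → up e → ¬ up o → b o + s o * θ ≤ b e + s e * θ) := by
  intro e o g1 g2 g3 g4 he ho
  have := h o e (by omega) (by omega) (by omega) (by omega) ho (not_not_intro he)
  linarith

/-- INFIMUM STRUCTURE FACING THE PREVIOUS WINDOW: if `i`, `i+d+1` are upper lines, `i+1` is a lower line,
`T[i, i+d]`, `T[i+1, i+d+1]` are non-empty, disjoint, and `T[i, i+d]` lies to the left (row `i` moves right), then
at `r = inf T[i+1, i+d+1]` some lower line `o` of `[i+1, i+d]` meets the NEW upper line `i+d+1`, every comparison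
of `[i+1, i+d+1]` is `≥ 0`, `T[i+1, i+d+1] ≥ r` with points below `r + ε`, and `T[i, i+d] < r`. -/
theorem inf_new_partner (up : ℕ → Prop) (s b : ℕ → ℝ) (i d : ℕ) (hd : 1 ≤ d) (hup0 : up i) (hup1 : up (i + d + 1))
    (hlow1 : ¬ up (i + 1))
    (hA0 : ∃ θ : ℝ, (∀ e o : ℕ, i ≤ e → e ≤ i + d → i ≤ o → o ≤ i + d → up e → ¬ up o → b o + s o * θ < b e + s e * θ)) (hA1 : ∃ θ : ℝ,
          (∀ e o : ℕ, i + 1 ≤ e → e ≤ i + d + 1 → i + 1 ≤ o → o ≤ i + d + 1 → up e → ¬ up o → b o + s o * θ < b e + s e * θ))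
    (hdis0 : ∀ θ : ℝ, ¬ ((∀ e o : ℕ, i ≤ e → e ≤ i + d → i ≤ o → o ≤ i + d → up e → ¬ up o → b o + s o * θ < b e + s e * θ) ∧
          (∀ e o : ℕ, i + 1 ≤ e → e ≤ i + d + 1 → i + 1 ≤ o → o ≤ i + d + 1 → up e → ¬ up o → b o + s o * θ < b e + s e * θ)))
    (hR0 : ∀ θ θ' : ℝ, (∀ e o : ℕ, i ≤ e → e ≤ i + d → i ≤ o → o ≤ i + d → up e → ¬ up o → b o + s o * θ < b e + s e * θ) →
          (∀ e o : ℕ, i + 1 ≤ e → e ≤ i + d + 1 → i + 1 ≤ o → o ≤ i + d + 1 → up e → ¬ up o → b o + s o * θ' < b e + s e * θ') → θ < θ') :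
    ∃ (r : ℝ) (o : ℕ), i + 1 ≤ o ∧ o ≤ i + d ∧ ¬ up o ∧
      b o + s o * r = b (i + d + 1) + s (i + d + 1) * r ∧
      (∀ e o : ℕ, i + 1 ≤ e → e ≤ i + d + 1 → i + 1 ≤ o → o ≤ i + d + 1 → up e → ¬ up o → b o + s o * r ≤ b e + s e * r) ∧
      (∀ θ : ℝ, (∀ e o : ℕ, i + 1 ≤ e → e ≤ i + d + 1 → i + 1 ≤ o → o ≤ i + d + 1 → up e → ¬ up o → b o + s o * θ < b e + s e * θ) → r ≤ θ) ∧
      (∀ ε : ℝ, 0 < ε → ∃ θ : ℝ, (∀ e o : ℕ, i + 1 ≤ e → e ≤ i + d + 1 → i + 1 ≤ o → o ≤ i + d + 1 → up e → ¬ up o → b o + s o * θ < b e + s e * θ) ∧ θ < r + ε) ∧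
      (∀ θ' : ℝ, (∀ e o : ℕ, i ≤ e → e ≤ i + d → i ≤ o → o ≤ i + d → up e → ¬ up o → b o + s o * θ' < b e + s e * θ') → θ' < r) := by
  obtain ⟨r, o, h1, h2, ho, heq, hdom, hge, happ, hlt⟩ :=
    step_inf_structure (fun t => up (i + d + 1 - t)) (fun t => s (i + d + 1 - t)) (fun t => b (i + d + 1 - t)) 0 d
      (by show up (i + d + 1 - 0); rw [Nat.sub_zero]; exact hup1)
      (by show up (i + d + 1 - (0 + d + 1)); rw [(by omega : i + d + 1 - (0 + d + 1) = i)]; exact hup0)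
      ⟨d, by omega, by omega, by show ¬ up (i + d + 1 - d); rw [(by omega : i + d + 1 - d = i + 1)]; exact hlow1⟩
      (hA1.imp fun θ h => reidx_to up s b (i + d + 1) _ _ _ _ (by omega) (by omega) θ h)
      (hA0.imp fun θ h => reidx_to up s b (i + d + 1) _ _ _ _ (by omega) (by omega) θ h)
      (fun θ h => hdis0 θ ⟨reidx_of up s b (i + d + 1) _ _ _ _ (by omega) (by omega) θ h.2,
        reidx_of up s b (i + d + 1) _ _ _ _ (by omega) (by omega) θ h.1⟩)
      (fun θ θ' h h' => hR0 θ' θ (reidx_of up s b (i + d + 1) _ _ _ _ (by omega) (by omega) θ' h')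
        (reidx_of up s b (i + d + 1) _ _ _ _ (by omega) (by omega) θ h))
  refine ⟨r, i + d + 1 - o, by omega, by omega, ho, ?_, ?_, ?_, ?_, ?_⟩
  · have heq' : b (i + d + 1 - o) + s (i + d + 1 - o) * r = b (i + d + 1 - 0) + s (i + d + 1 - 0) * r := heq
    rw [Nat.sub_zero] at heq'
    exact heq'
  · exact reidxle_of up s b (i + d + 1) _ _ _ _ (by omega) (by omega) r hdom
  · exact fun θ hθ => hge θ (reidx_to up s b (i + d + 1) _ _ _ _ (by omega) (by omega) θ hθ)
  · intro ε hε
    obtain ⟨θ, hθ, hθr⟩ := happ ε hε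
    exact ⟨θ, reidx_of up s b (i + d + 1) _ _ _ _ (by omega) (by omega) θ hθ, hθr⟩
  · exact fun θ' hθ' => hlt θ' (reidx_to up s b (i + d + 1) _ _ _ _ (by omega) (by omega) θ' hθ')

/-- INFIMUM STRUCTURE WITH A LOWER OUTER LINE: if `i+3`, `i+d+4` are lower lines and `i+d+1` is an upper line
(`d ≥ 3`), `T[i+3, i+d+3]`, `T[i+4, i+d+4]` are non-empty, disjoint, and `T[i+4, i+d+4]` lies to the left (row `i+3`
moves left), then at `r = inf T[i+3, i+d+3]` some upper line `e` of `[i+4, i+d+3]` meets the outer lower line `i+3`,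
every comparison of `[i+3, i+d+3]` is `≥ 0`, `T[i+3, i+d+3] ≥ r` with points below `r + ε`, and `T[i+4, i+d+4] < r`. -/
theorem inf_low_outer (up : ℕ → Prop) (s b : ℕ → ℝ) (i d : ℕ) (hd : 3 ≤ d) (hlow3 : ¬ up (i + 3))
    (hlow4 : ¬ up (i + d + 4)) (hup1 : up (i + d + 1))
    (hA3 : ∃ θ : ℝ, (∀ e o : ℕ, i + 3 ≤ e → e ≤ i + d + 3 → i + 3 ≤ o → o ≤ i + d + 3 → up e → ¬ up o → b o + s o * θ < b e + s e * θ)) (hA4 : ∃ θ : ℝ,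
          (∀ e o : ℕ, i + 4 ≤ e → e ≤ i + d + 4 → i + 4 ≤ o → o ≤ i + d + 4 → up e → ¬ up o → b o + s o * θ < b e + s e * θ))
    (hdis3 : ∀ θ : ℝ, ¬ ((∀ e o : ℕ, i + 3 ≤ e → e ≤ i + d + 3 → i + 3 ≤ o → o ≤ i + d + 3 → up e → ¬ up o → b o + s o * θ < b e + s e * θ) ∧
          (∀ e o : ℕ, i + 4 ≤ e → e ≤ i + d + 4 → i + 4 ≤ o → o ≤ i + d + 4 → up e → ¬ up o → b o + s o * θ < b e + s e * θ)))
    (hL3 : ∀ θ θ' : ℝ, (∀ e o : ℕ, i + 3 ≤ e → e ≤ i + d + 3 → i + 3 ≤ o → o ≤ i + d + 3 → up e → ¬ up o → b o + s o * θ < b e + s e * θ) →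
          (∀ e o : ℕ, i + 4 ≤ e → e ≤ i + d + 4 → i + 4 ≤ o → o ≤ i + d + 4 → up e → ¬ up o → b o + s o * θ' < b e + s e * θ') → θ' < θ) :
    ∃ (r : ℝ) (e : ℕ), i + 4 ≤ e ∧ e ≤ i + d + 3 ∧ up e ∧
      b e + s e * r = b (i + 3) + s (i + 3) * r ∧
      (∀ e o : ℕ, i + 3 ≤ e → e ≤ i + d + 3 → i + 3 ≤ o → o ≤ i + d + 3 → up e → ¬ up o → b o + s o * r ≤ b e + s e * r) ∧
      (∀ θ : ℝ, (∀ e o : ℕ, i + 3 ≤ e → e ≤ i + d + 3 → i + 3 ≤ o → o ≤ i + d + 3 → up e → ¬ up o → b o + s o * θ < b e + s e * θ) → r ≤ θ) ∧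
      (∀ ε : ℝ, 0 < ε → ∃ θ : ℝ, (∀ e o : ℕ, i + 3 ≤ e → e ≤ i + d + 3 → i + 3 ≤ o → o ≤ i + d + 3 → up e → ¬ up o → b o + s o * θ < b e + s e * θ) ∧ θ < r + ε) ∧
      (∀ θ' : ℝ, (∀ e o : ℕ, i + 4 ≤ e → e ≤ i + d + 4 → i + 4 ≤ o → o ≤ i + d + 4 → up e → ¬ up o → b o + s o * θ' < b e + s e * θ') → θ' < r) := by
  obtain ⟨r, e, h1, h2, he, heq, hdom, hge, happ, hlt⟩ :=
    step_inf_structure (fun t => ¬ up t) (fun t => -s t) (fun t => -b t) (i + 3) d hlow3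
      (by show ¬ up (i + 3 + d + 1); rw [(by omega : i + 3 + d + 1 = i + d + 4)]; exact hlow4)
      ⟨i + d + 1, by omega, by omega, not_not_intro hup1⟩
      (hA3.imp fun θ h => neg_to up s b _ _ _ _ rfl (by omega) θ h)
      (hA4.imp fun θ h => neg_to up s b _ _ _ _ (by omega) (by omega) θ h)
      (fun θ h => hdis3 θ ⟨neg_of up s b _ _ _ _ rfl (by omega) θ h.1,
        neg_of up s b _ _ _ _ (by omega) (by omega) θ h.2⟩)
      (fun θ θ' h h' => hL3 θ θ' (neg_of up s b _ _ _ _ rfl (by omega) θ h)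
        (neg_of up s b _ _ _ _ (by omega) (by omega) θ' h'))
  refine ⟨r, e, by omega, by omega, Classical.not_not.mp he, ?_, ?_, ?_, ?_, ?_⟩
  · have heq' : -b e + -s e * r = -b (i + 3) + -s (i + 3) * r := heq
    linarith
  · exact negle_of up s b _ _ _ _ rfl (by omega) r hdom
  · exact fun θ hθ => hge θ (neg_to up s b _ _ _ _ rfl (by omega) θ hθ)
  · intro ε hε
    obtain ⟨θ, hθ, hθr⟩ := happ ε hε
    exact ⟨θ, neg_of up s b _ _ _ _ rfl (by omega) θ hθ, hθr⟩
  · exact fun θ' hθ' => hlt θ' (neg_to up s b _ _ _ _ (by omega) (by omega) θ' hθ')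

/-- Separation sets are intervals: separated at `x` and at `y` implies separated at every point between. -/
theorem sep_convex (up : ℕ → Prop) (s b : ℕ → ℝ) (lo hi : ℕ) (x y θ : ℝ)
    (hx : (∀ e o : ℕ, lo ≤ e → e ≤ hi → lo ≤ o → o ≤ hi → up e → ¬ up o → b o + s o * x < b e + s e * x))
    (hy : (∀ e o : ℕ, lo ≤ e → e ≤ hi → lo ≤ o → o ≤ hi → up e → ¬ up o → b o + s o * y < b e + s e * y))
    (h1 : x ≤ θ) (h2 : θ ≤ y) :
    (∀ e o : ℕ, lo ≤ e → e ≤ hi → lo ≤ o → o ≤ hi → up e → ¬ up o → b o + s o * θ < b e + s e * θ) := by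
  intro e o g1 g2 g3 g4 he ho
  have px := hx e o g1 g2 g3 g4 he ho
  have py := hy e o g1 g2 g3 g4 he ho
  have := affine_pos_between (b e - b o) (s e - s o) x y θ h1 h2 (by linarith) (by linarith)
  linarith

/-- FOUR-STEP LAW, pattern `(R, R, L, L)`: rows `i, …, i+3` step, rows `i`, `i+1` move right, rows `i+2`, `i+3`
move left — impossible (the squeeze `inf T[i+1, i+d+1] = inf T[i+3, i+d+3]`). -/
theorem four_rrll (up : ℕ → Prop) (s b : ℕ → ℝ) (i d : ℕ) (hd : 3 ≤ d) (hup0 : up i) (hlow1 : ¬ up (i + 1))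
    (hup2 : up (i + 2)) (hlow3 : ¬ up (i + 3)) (hup1 : up (i + d + 1)) (hlow2 : ¬ up (i + d + 2))
    (hup3 : up (i + d + 3)) (hlow4 : ¬ up (i + d + 4))
    (hA0 : ∃ θ : ℝ, (∀ e o : ℕ, i ≤ e → e ≤ i + d → i ≤ o → o ≤ i + d → up e → ¬ up o → b o + s o * θ < b e + s e * θ)) (hA1 : ∃ θ : ℝ,
          (∀ e o : ℕ, i + 1 ≤ e → e ≤ i + d + 1 → i + 1 ≤ o → o ≤ i + d + 1 → up e → ¬ up o → b o + s o * θ < b e + s e * θ))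
    (hA2 : ∃ θ : ℝ, (∀ e o : ℕ, i + 2 ≤ e → e ≤ i + d + 2 → i + 2 ≤ o → o ≤ i + d + 2 → up e → ¬ up o → b o + s o * θ < b e + s e * θ)) (hA3 : ∃ θ : ℝ,
          (∀ e o : ℕ, i + 3 ≤ e → e ≤ i + d + 3 → i + 3 ≤ o → o ≤ i + d + 3 → up e → ¬ up o → b o + s o * θ < b e + s e * θ))
    (hA4 : ∃ θ : ℝ, (∀ e o : ℕ, i + 4 ≤ e → e ≤ i + d + 4 → i + 4 ≤ o → o ≤ i + d + 4 → up e → ¬ up o → b o + s o * θ < b e + s e * θ))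
    (hdis0 : ∀ θ : ℝ, ¬ ((∀ e o : ℕ, i ≤ e → e ≤ i + d → i ≤ o → o ≤ i + d → up e → ¬ up o → b o + s o * θ < b e + s e * θ) ∧
          (∀ e o : ℕ, i + 1 ≤ e → e ≤ i + d + 1 → i + 1 ≤ o → o ≤ i + d + 1 → up e → ¬ up o → b o + s o * θ < b e + s e * θ)))
    (hdis1 : ∀ θ : ℝ, ¬ ((∀ e o : ℕ, i + 1 ≤ e → e ≤ i + d + 1 → i + 1 ≤ o → o ≤ i + d + 1 → up e → ¬ up o → b o + s o * θ < b e + s e * θ) ∧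
          (∀ e o : ℕ, i + 2 ≤ e → e ≤ i + d + 2 → i + 2 ≤ o → o ≤ i + d + 2 → up e → ¬ up o → b o + s o * θ < b e + s e * θ)))
    (hdis2 : ∀ θ : ℝ, ¬ ((∀ e o : ℕ, i + 2 ≤ e → e ≤ i + d + 2 → i + 2 ≤ o → o ≤ i + d + 2 → up e → ¬ up o → b o + s o * θ < b e + s e * θ) ∧
          (∀ e o : ℕ, i + 3 ≤ e → e ≤ i + d + 3 → i + 3 ≤ o → o ≤ i + d + 3 → up e → ¬ up o → b o + s o * θ < b e + s e * θ)))
    (hdis3 : ∀ θ : ℝ, ¬ ((∀ e o : ℕ, i + 3 ≤ e → e ≤ i + d + 3 → i + 3 ≤ o → o ≤ i + d + 3 → up e → ¬ up o → b o + s o * θ < b e + s e * θ) ∧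
          (∀ e o : ℕ, i + 4 ≤ e → e ≤ i + d + 4 → i + 4 ≤ o → o ≤ i + d + 4 → up e → ¬ up o → b o + s o * θ < b e + s e * θ)))
    (hR0 : ∀ θ θ' : ℝ, (∀ e o : ℕ, i ≤ e → e ≤ i + d → i ≤ o → o ≤ i + d → up e → ¬ up o → b o + s o * θ < b e + s e * θ) →
          (∀ e o : ℕ, i + 1 ≤ e → e ≤ i + d + 1 → i + 1 ≤ o → o ≤ i + d + 1 → up e → ¬ up o → b o + s o * θ' < b e + s e * θ') → θ < θ')
    (hR1 : ∀ θ θ' : ℝ, (∀ e o : ℕ, i + 1 ≤ e → e ≤ i + d + 1 → i + 1 ≤ o → o ≤ i + d + 1 → up e → ¬ up o → b o + s o * θ < b e + s e * θ) →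
          (∀ e o : ℕ, i + 2 ≤ e → e ≤ i + d + 2 → i + 2 ≤ o → o ≤ i + d + 2 → up e → ¬ up o → b o + s o * θ' < b e + s e * θ') → θ < θ')
    (hL2 : ∀ θ θ' : ℝ, (∀ e o : ℕ, i + 2 ≤ e → e ≤ i + d + 2 → i + 2 ≤ o → o ≤ i + d + 2 → up e → ¬ up o → b o + s o * θ < b e + s e * θ) →
          (∀ e o : ℕ, i + 3 ≤ e → e ≤ i + d + 3 → i + 3 ≤ o → o ≤ i + d + 3 → up e → ¬ up o → b o + s o * θ' < b e + s e * θ') → θ' < θ)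
    (hL3 : ∀ θ θ' : ℝ, (∀ e o : ℕ, i + 3 ≤ e → e ≤ i + d + 3 → i + 3 ≤ o → o ≤ i + d + 3 → up e → ¬ up o → b o + s o * θ < b e + s e * θ) →
          (∀ e o : ℕ, i + 4 ≤ e → e ≤ i + d + 4 → i + 4 ≤ o → o ≤ i + d + 4 → up e → ¬ up o → b o + s o * θ' < b e + s e * θ') → θ' < θ) : False := by
  have hd2 : 2 ≤ d := by omega
  -- the two monotonicities (triple laws)
  have hmono : s (i + 2) < s (i + d + 1) :=
    triple_mid_right up s b i d hd2 hlow1 hup2 hup1 hlow2 hup3 hA0 hA1 hA2 hA3 hdis0 hdis1 hdis2 (Or.inl hR0) hR1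
      (Or.inr hL2)
  have hmono' : s (i + 3) < s (i + d + 2) :=
    mono_low up s b i d hd2 hup2 hlow3 hlow2 hup3 hlow4 hA1 hA2 hA3 hA4 hdis1 hdis2 hdis3 (Or.inl hR1) hL2 (Or.inr hL3)
  -- the two infimum structures
  obtain ⟨ι₁, o₁, ho1a, ho1b, ho1, heq1, hdom1, hge1, happ1, hlt0⟩ :=
    inf_new_partner up s b i d (by omega) hup0 hup1 hlow1 hA0 hA1 hdis0 hR0
  obtain ⟨ι₃, e₃, he3a, he3b, he3, heq3, hdom3, hge3, happ3, -⟩ :=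
    inf_low_outer up s b i d hd hlow3 hlow4 hup1 hA3 hA4 hdis3 hL3
  obtain ⟨θ₀, hθ₀⟩ := hA0
  obtain ⟨θ₁, hθ₁⟩ := hA1
  obtain ⟨θ₂, hθ₂⟩ := hA2
  obtain ⟨θ₃, hθ₃⟩ := hA3
  -- the four values of `c = S_{i+d+1} - S_{i+2}` and `c' = S_{i+3} - S_{i+d+2}` at `ι₁`, `ι₃`
  have hc1 : b (i + d + 1) + s (i + d + 1) * ι₁ ≤ b (i + 2) + s (i + 2) * ι₁ := by
    have := hdom1 (i + 2) o₁ (by omega) (by omega) (by omega) (by omega) hup2 ho1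
    linarith
  have hc'3 : b (i + d + 2) + s (i + d + 2) * ι₃ ≤ b (i + 3) + s (i + 3) * ι₃ := by
    have := hdom3 e₃ (i + d + 2) (by omega) (by omega) (by omega) (by omega) he3 hlow2
    linarith
  have hc3 : b (i + 2) + s (i + 2) * ι₃ ≤ b (i + d + 1) + s (i + d + 1) * ι₃ := by
    refine affine_le_at_inf (s (i + 2)) (b (i + 2)) (s (i + d + 1)) (b (i + d + 1)) ι₃ ?_
    intro ε hε
    obtain ⟨θ, hθ, hθr⟩ := happ3 ε hε
    exact ⟨θ, le_of_lt (gap_left_up up s b i d θ hd2 hup2 hup1 hθ (hdis2 θ)), hθr, hge3 θ hθ⟩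
  have hc'1 : b (i + 3) + s (i + 3) * ι₁ ≤ b (i + d + 2) + s (i + d + 2) * ι₁ := by
    refine affine_le_at_inf (s (i + 3)) (b (i + 3)) (s (i + d + 2)) (b (i + d + 2)) ι₁ ?_
    intro ε hε
    obtain ⟨θ, hθ, hθr⟩ := happ1 ε hε
    exact ⟨θ, le_of_lt (gap_right_low up s b i d θ hd2 hlow3 hlow2 hθ (hdis1 θ)), hθr, hge1 θ hθ⟩
  -- `ι₁ < θ₁ ∈ T[i+1, i+d+1]` and `ι₃ < θ₃ ∈ T[i+3, i+d+3]` (the infima are tight, hence not separation points)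
  have hρ : ι₁ < θ₁ := by
    rcases eq_or_lt_of_le (hge1 θ₁ hθ₁) with h | h
    · exfalso
      have := hθ₁ (i + d + 1) o₁ (by omega) (by omega) (by omega) (by omega) hup1 ho1
      rw [← h] at this
      linarith
    · exact h
  have hσ : ι₃ < θ₃ := by
    rcases eq_or_lt_of_le (hge3 θ₃ hθ₃) with h | h
    · exfalso
      have := hθ₃ e₃ (i + 3) (by omega) (by omega) (by omega) (by omega) he3 hlow3
      rw [← h] at this
      linarith
    · exact h
  -- row-`(i+1)` exactness on `T[i+1, i+d+1] ∩ T[i+3, i+d+3]`, witnessed by the pair `(i+2, i+d+2)`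
  have hz : ∀ θ : ℝ, ι₁ < θ → θ < θ₁ → ι₃ < θ → θ < θ₃ →
      b (i + 2) + s (i + 2) * θ ≤ b (i + d + 2) + s (i + d + 2) * θ := by
    intro θ k1 k2 k3 k4
    obtain ⟨x₁, hx₁, hx₁r⟩ := happ1 (θ - ι₁) (by linarith)
    have hT1 : (∀ e o : ℕ, i + 1 ≤ e → e ≤ i + d + 1 → i + 1 ≤ o → o ≤ i + d + 1 → up e → ¬ up o → b o + s o * θ < b e + s e * θ) :=
      sep_convex up s b (i + 1) (i + d + 1) x₁ θ₁ θ hx₁ hθ₁ (by linarith) (le_of_lt k2)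
    obtain ⟨x₃, hx₃, hx₃r⟩ := happ3 (θ - ι₃) (by linarith)
    have hT3 : (∀ e o : ℕ, i + 3 ≤ e → e ≤ i + d + 3 → i + 3 ≤ o → o ≤ i + d + 3 → up e → ¬ up o → b o + s o * θ < b e + s e * θ) :=
      sep_convex up s b (i + 3) (i + d + 3) x₃ θ₃ θ hx₃ hθ₃ (by linarith) (le_of_lt k4)
    refine new_low_le up s b i d θ hlow2 hT1 (not_sep_right up s b i d θ (hdis1 θ)) ?_
    intro e h1 h2 he hne
    have he3' : i + 3 ≤ e := by
      by_contra hlt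
      have hee : e = i + 1 := by omega
      rw [hee] at he
      exact hlow1 he
    exact hT3 e (i + d + 2) he3' (by omega) (by omega) (by omega) he hlow2
  -- the outer points: `θ₀ ∈ T[i, i+d]` left of `ι₁`, `θ₂ ∈ T[i+2, i+d+2]` right of `ι₁`, where `S_{i+2} > S_{i+3}`
  have ha : θ₀ ≤ ι₁ := le_of_lt (hlt0 θ₀ hθ₀)
  have ha' : b (i + 3) + s (i + 3) * θ₀ < b (i + 2) + s (i + 2) * θ₀ :=
    hθ₀ (i + 2) (i + 3) (by omega) (by omega) (by omega) (by omega) hup2 hlow3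
  have hc : ι₁ ≤ θ₂ := le_trans (hge1 θ₁ hθ₁) (le_of_lt (hR1 θ₁ θ₂ hθ₁ hθ₂))
  have hc' : b (i + 3) + s (i + 3) * θ₂ < b (i + 2) + s (i + 2) * θ₂ :=
    hθ₂ (i + 2) (i + 3) (by omega) (by omega) (by omega) (by omega) hup2 hlow3
  exact four_rrll_core (s (i + 2)) (b (i + 2)) (s (i + 3)) (b (i + 3)) (s (i + d + 1)) (b (i + d + 1))
    (s (i + d + 2)) (b (i + d + 2)) ι₁ ι₃ θ₁ θ₃ θ₀ θ₂ hmono hmono' hc1 hc3 hc'3 hc'1 hρ hσ hz ha ha' hc hc'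

end Summit.ValiantsHypothesis.ValiantsHypothesis.Theorems.KPlusLogSqLawStepFourInf
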